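import Summits.Ventures.CertifiedArithmetic.LowPrec.PatternSubnormal

/-!
# Remark E5′ below the normal range: per-band constants on the subnormal bands (ulps = quanta)

Venture: CertifiedArithmetic (T1-LOWPREC-ENVELOPES). HONEST FRAMING: certified error envelopes and
provably optimal rounding/accumulation schemes for low-precision formats under stated cost models;
every table by two implementations; no hardware or vendor claims.

`PatternBands.lean` / `PatternBandsUlp.lean` kernel-check the per-band constants of Remark E5′
(THEOREMS-R1-BANDS) on the NORMAL bands of the destination. This file does the SUBNORMAL bands:
low band `γ` of destination `R` is the binade `2^m · quantum / 2^(γ+1) ≤ |t| < 2^m · quantum / 2^γ`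
(`γ = 0` is the top subnormal binade; the bands continue below the quantum), tested on a magnitude
`N · 2^E · quantum` by `Format.lowBandB γ N E` (`PatternSubnormal.lean`). There the grid of `R` is
uniform with spacing `quantum` = the ulp of the whole low range, the magnitude is the low pattern
`lowN / 2^lowK · quantum`, and the error of a rounding with a LOW BRIDGE (`LowBridge`;
`lowBridgeNE/TZ/RD/RU`) is `errL (lowN) (lowK) · quantum`. Products and aligned sums are treated at
once through an OPERATION MODEL (`OpModel`: the operation, the kernel-reducible list of its
magnitude patterns `(N, E)` — `mulPats`, `addPats` — and the two realisability facts), giving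
SOUNDNESS `low_le` and ATTAINMENT `low_attained` of `maxList0 (lowErrsOf errL R γ pats)` in units of
the quantum (the ULP column; times `quantum` the ABSOLUTE column) — `mul_low_le`, `add_low_le`, … —
and the named constants `envconstMulLowNE/TZ/Dir`, `envconstAddLowNE/TZ/Dir`. The relative column:
`PatternSubnormalRel.lean`; FP6/FP4 instances: `PatternSubnormalBandsFP6FP4.lean`.
-/

namespace Literature.ComputerArithmetic.FloatingPoint

open Format

/-- A ROUNDING WITH A LOW BRIDGE at destination `R`: the rounding `fl`, its closed-form low-range
error `errL n k` in units of the quantum, the sign at which `(n, k)` attains it, and the two bridge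
facts of `PatternSubnormal.lean`. [folklore] -/
structure LowBridge (R : Format) where
  /-- The rounding into `R`. -/
  fl : ℚ → MiniFloat R
  /-- The closed-form low-range error in units of the quantum. -/
  errL : ℕ → ℕ → ℚ
  /-- The sign (`true` = negative) at which `(n, k)` attains `errL n k`. -/
  sgn : ℕ → ℕ → Bool
  /-- Errors are nonnegative. -/
  errL_nonneg : ∀ n k, 0 ≤ errL n k
  /-- Bridge, inequality, both signs. -/
  abs_le : ∀ (t : ℚ) (n k : ℕ), n < 2 ^ (R.manBits + 1) * 2 ^ k →
    |t| = (n : ℚ) / 2 ^ k * R.quantum → |t| ≤ R.maxRat → |t - (fl t).toRat| ≤ errL n k * R.quantum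
  /-- Bridge, equality at the prescribed sign. -/
  abs_eq : ∀ (t : ℚ) (n k : ℕ), t ≠ 0 → (t < 0 ↔ sgn n k = true) →
    n < 2 ^ (R.manBits + 1) * 2 ^ k → |t| = (n : ℚ) / 2 ^ k * R.quantum → |t| ≤ R.maxRat →
      |t - (fl t).toRat| = errL n k * R.quantum

namespace MiniFloat

/-- ROUND TO NEAREST EVEN with its low bridge. [folklore] -/
def lowBridgeNE (R : Format) : LowBridge R where
  fl := roundNE R
  errL := lowErrNE
  sgn := fun _ _ => false
  errL_nonneg := lowErrNE_nonneg
  abs_le := fun _ _ _ hlow ht hmax => (abs_sub_roundNE_low hlow ht hmax).le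
  abs_eq := fun _ _ _ _ _ hlow ht hmax => abs_sub_roundNE_low hlow ht hmax

/-- ROUND TOWARD ZERO with its low bridge. [folklore] -/
def lowBridgeTZ (R : Format) : LowBridge R where
  fl := roundTowardZero R
  errL := lowErrTZ
  sgn := fun _ _ => false
  errL_nonneg := lowErrTZ_nonneg
  abs_le := fun _ _ _ hlow ht hmax => (abs_sub_roundTowardZero_low hlow ht hmax).le
  abs_eq := fun _ _ _ _ _ hlow ht hmax => abs_sub_roundTowardZero_low hlow ht hmax

/-- ROUND DOWN with its low bridge: error `max(TZ, AW)`, attained at a negative argument when the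
away error exceeds the toward-zero error. [folklore] -/
def lowBridgeRD (R : Format) : LowBridge R where
  fl := roundDown R
  errL := lowErrDir
  sgn := fun n k => decide (lowErrTZ n k < lowErrAW n k)
  errL_nonneg := lowErrDir_nonneg
  abs_le := fun _ _ _ hlow ht hmax => abs_sub_roundDown_low_le hlow ht hmax
  abs_eq := fun t n k _ hsgn hlow ht hmax => by
    have hq := R.quantum_pos
    by_cases h : lowErrTZ n k < lowErrAW n k
    · rw [sub_roundDown_low_neg (hsgn.mpr (decide_eq_true h)) hlow ht hmax,
        abs_of_nonneg (mul_nonneg (lowErrAW_nonneg n k) hq.le), lowErrDir, max_eq_right h.le]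
    · have hpos : 0 ≤ t := not_lt.mp fun hneg => h (of_decide_eq_true (hsgn.mp hneg))
      rw [sub_roundDown_low hpos hlow ht hmax,
        abs_of_nonneg (mul_nonneg (lowErrTZ_nonneg n k) hq.le), lowErrDir,
        max_eq_left (not_lt.mp h)]

/-- ROUND UP with its low bridge (mirror image of round down). [folklore] -/
def lowBridgeRU (R : Format) : LowBridge R where
  fl := roundUp R
  errL := lowErrDir
  sgn := fun n k => decide (lowErrAW n k < lowErrTZ n k)
  errL_nonneg := lowErrDir_nonneg
  abs_le := fun _ _ _ hlow ht hmax => abs_sub_roundUp_low_le hlow ht hmax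
  abs_eq := fun t n k hne0 hsgn hlow ht hmax => by
    have hq := R.quantum_pos
    by_cases h : lowErrAW n k < lowErrTZ n k
    · rw [abs_sub_comm, roundUp_sub_low_neg (le_of_lt (hsgn.mpr (decide_eq_true h))) hlow ht hmax,
        abs_of_nonneg (mul_nonneg (lowErrTZ_nonneg n k) hq.le), lowErrDir, max_eq_left h.le]
    · have hpos : 0 < t := by
        rcases lt_or_gt_of_ne hne0 with hneg | hpos
        · exact absurd (of_decide_eq_true (hsgn.mp hneg)) h
        · exact hpos
      rw [abs_sub_comm, roundUp_sub_low hpos hlow ht hmax,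
        abs_of_nonneg (mul_nonneg (lowErrAW_nonneg n k) hq.le), lowErrDir,
        max_eq_right (not_lt.mp h)]

end MiniFloat

/-! ### Magnitude patterns of an operation and their low-band errors -/

/-- THE LOW-BAND ERRORS of a list of magnitude patterns `(N, E)`: the placed ones, with their
errors. [folklore] -/
def lowErrsOf (errL : ℕ → ℕ → ℚ) (R : Format) (γ : ℕ) (pats : List (ℕ × ℤ)) : List ℚ :=
  pats.flatMap fun p => lowEntry errL R γ p.1 p.2

/-- Membership in `lowErrsOf`. [folklore] -/
theorem mem_lowErrsOf {errL : ℕ → ℕ → ℚ} {R : Format} {γ : ℕ} {pats : List (ℕ × ℤ)} {c : ℚ} :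
    c ∈ lowErrsOf errL R γ pats ↔
      ∃ (N : ℕ) (E : ℤ), (N, E) ∈ pats ∧ R.lowBandB γ N E = true ∧ c = errL (lowN N E) (lowK E) := by
  simp only [lowErrsOf, List.mem_flatMap, mem_lowEntry]
  constructor
  · rintro ⟨⟨N, E⟩, hp, hb, hc⟩; exact ⟨N, E, hp, hb, hc⟩
  · rintro ⟨N, E, hp, hb, hc⟩; exact ⟨(N, E), hp, hb, hc⟩

/-- THE MAGNITUDE PATTERNS OF PRODUCTS: `(k₁ k₂, j₁ + j₂ + mulExpOffset)` over `sigShifts X ×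
sigShifts Y` (`|a · b| = N · 2^E · quantum_R`, `PatternEnvelopeMul.abs_mul_toRat_eq`). [folklore] -/
def mulPats (X Y R : Format) : List (ℕ × ℤ) :=
  X.sigShifts.flatMap fun p => Y.sigShifts.map fun q =>
    (p.1 * q.1, ((p.2 + q.2 : ℕ) : ℤ) + mulExpOffset X Y R)

/-- Membership in `mulPats`. [folklore] -/
theorem mem_mulPats {X Y R : Format} {N : ℕ} {E : ℤ} : (N, E) ∈ mulPats X Y R ↔
    ∃ k₁ j₁ k₂ j₂ : ℕ, (k₁, j₁) ∈ X.sigShifts ∧ (k₂, j₂) ∈ Y.sigShifts ∧ N = k₁ * k₂ ∧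
      E = ((j₁ + j₂ : ℕ) : ℤ) + mulExpOffset X Y R := by
  simp only [mulPats, List.mem_flatMap, List.mem_map, Prod.mk.injEq]
  constructor
  · rintro ⟨⟨k₁, j₁⟩, h1, ⟨k₂, j₂⟩, h2, hN, hE⟩; exact ⟨k₁, j₁, k₂, j₂, h1, h2, hN.symm, hE.symm⟩
  · rintro ⟨k₁, j₁, k₂, j₂, h1, h2, rfl, rfl⟩; exact ⟨(k₁, j₁), h1, (k₂, j₂), h2, rfl, rfl⟩

/-- THE MAGNITUDE PATTERNS OF SUMS: the aligned integer sum and the common exponent over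
`sigShiftsC X × sigShiftsC Y × {same, opposite signs}` (`PatternEnvelopeAdd.abs_add_toRat_eq`).
[folklore] -/
def addPats (X Y R : Format) : List (ℕ × ℤ) :=
  X.sigShiftsC.flatMap fun p => Y.sigShiftsC.flatMap fun q => [false, true].map fun opp =>
    (addPatN p.1 ((p.2 : ℤ) + expOffset X R) q.1 ((q.2 : ℤ) + expOffset Y R) opp,
      min ((p.2 : ℤ) + expOffset X R) ((q.2 : ℤ) + expOffset Y R))

/-- Membership in `addPats`. [folklore] -/
theorem mem_addPats {X Y R : Format} {N : ℕ} {E : ℤ} : (N, E) ∈ addPats X Y R ↔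
    ∃ (k₁ j₁ k₂ j₂ : ℕ) (opp : Bool), (k₁, j₁) ∈ X.sigShiftsC ∧ (k₂, j₂) ∈ Y.sigShiftsC ∧
      N = addPatN k₁ ((j₁ : ℤ) + expOffset X R) k₂ ((j₂ : ℤ) + expOffset Y R) opp ∧
      E = min ((j₁ : ℤ) + expOffset X R) ((j₂ : ℤ) + expOffset Y R) := by
  simp only [addPats, List.mem_flatMap, List.mem_map, Prod.mk.injEq]
  constructor
  · rintro ⟨⟨k₁, j₁⟩, h1, ⟨k₂, j₂⟩, h2, opp, -, hN, hE⟩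
    exact ⟨k₁, j₁, k₂, j₂, opp, h1, h2, hN.symm, hE.symm⟩
  · rintro ⟨k₁, j₁, k₂, j₂, opp, h1, h2, rfl, rfl⟩
    exact ⟨(k₁, j₁), h1, (k₂, j₂), h2, opp, by cases opp <;> simp, rfl, rfl⟩

/-- AN OPERATION MODEL: a binary operation on data of `X` and `Y`, the list of its magnitude
patterns in quanta of `R`, and realisability both ways (every result has a listed pattern; every
listed nonzero pattern is a result of either sign). [folklore] -/
structure OpModel (X Y R : Format) where
  /-- The exact operation. -/
  op : MiniFloat X → MiniFloat Y → ℚ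
  /-- Its magnitude patterns `(N, E)`: `|op a b| = N · 2^E · quantum_R`. -/
  pats : List (ℕ × ℤ)
  /-- Every result has a listed pattern. -/
  mem_pats : ∀ (a : MiniFloat X) (b : MiniFloat Y),
    ∃ (N : ℕ) (E : ℤ), (N, E) ∈ pats ∧ |op a b| = (N : ℚ) * 2 ^ E * R.quantum
  /-- Every listed nonzero pattern is realised by data, with either sign. -/
  realise : ∀ (N : ℕ) (E : ℤ) (neg : Bool), (N, E) ∈ pats → N ≠ 0 →
    ∃ (a : MiniFloat X) (b : MiniFloat Y),
      |op a b| = (N : ℚ) * 2 ^ E * R.quantum ∧ (op a b < 0 ↔ neg = true)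

namespace MiniFloat

variable {X Y : Format}

/-- THE PRODUCT MODEL. [folklore] -/
def mulModel (X Y R : Format) : OpModel X Y R where
  op := fun a b => a.toRat * b.toRat
  pats := mulPats X Y R
  mem_pats := fun a b => ⟨a.sig * b.sig, _, mem_mulPats.mpr ⟨a.sig, a.bshift, b.sig, b.bshift,
    mem_sigShifts.mpr ⟨a.sig_lt, a.bshift_le, a.sig_mul_pow_le_maxScaled⟩,
    mem_sigShifts.mpr ⟨b.sig_lt, b.bshift_le, b.sig_mul_pow_le_maxScaled⟩, rfl, rfl⟩,
    abs_mul_toRat_eq R a b⟩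
  realise := fun N E neg hmem hN => by
    obtain ⟨k₁, j₁, k₂, j₂, hk1, hk2, rfl, rfl⟩ := mem_mulPats.mp hmem
    exact exists_data_of_mem_sigShifts R hk1 hk2
      (Nat.pos_of_ne_zero fun h0 => hN (by rw [h0, zero_mul]))
      (Nat.pos_of_ne_zero fun h0 => hN (by rw [h0, mul_zero])) neg

/-- THE SUM MODEL. [folklore] -/
def addModel (X Y R : Format) : OpModel X Y R where
  op := fun a b => a.toRat + b.toRat
  pats := addPats X Y R
  mem_pats := fun a b => ⟨_, _, mem_addPats.mpr ⟨a.sig, a.bshift, b.sig, b.bshift, xor a.neg b.neg,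
    a.mem_sigShiftsC, b.mem_sigShiftsC, rfl, rfl⟩, abs_add_toRat_eq R a b⟩
  realise := fun N E neg hmem hN => by
    obtain ⟨k₁, j₁, k₂, j₂, opp, hk1, hk2, rfl, rfl⟩ := mem_addPats.mp hmem
    exact exists_data_add R hk1 hk2 opp neg hN

/-- A value in a low band is nonzero. [folklore] -/
theorem ne_zero_of_lowBand {R : Format} {t : ℚ} {γ : ℕ}
    (h1 : 2 ^ R.manBits * R.quantum ≤ |t| * 2 ^ (γ + 1)) : t ≠ 0 := by
  intro h0
  rw [h0, abs_zero, zero_mul] at h1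
  exact absurd h1 (not_le.mpr (mul_pos (by positivity) R.quantum_pos))

/-- A populated low band has a placed pattern. [folklore] -/
theorem lowErrsOf_ne_nil_of_band {R : Format} (errL : ℕ → ℕ → ℚ) (M : OpModel X Y R) (γ : ℕ)
    (a : MiniFloat X) (b : MiniFloat Y) (h1 : 2 ^ R.manBits * R.quantum ≤ |M.op a b| * 2 ^ (γ + 1))
    (h2 : |M.op a b| * 2 ^ (γ + 1) < 2 ^ (R.manBits + 1) * R.quantum) (h3 : |M.op a b| ≤ R.maxRat) :
    lowErrsOf errL R γ M.pats ≠ [] := by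
  obtain ⟨N, E, hmem, ht⟩ := M.mem_pats a b
  exact List.ne_nil_of_mem
    (mem_lowErrsOf.mpr ⟨N, E, hmem, (lowBandB_iff_of_eq ht).mpr ⟨h1, h2, h3⟩, rfl⟩)

/-- SOUNDNESS PER LOW BAND (quanta): for a rounding with a low bridge and an operation model, every
result in low band `γ` has error at most `maxList0 (lowErrsOf errL R γ pats) · quantum`. [folklore] -/
theorem low_le {R : Format} (B : LowBridge R) (M : OpModel X Y R) (γ : ℕ) (a : MiniFloat X)
    (b : MiniFloat Y) (h1 : 2 ^ R.manBits * R.quantum ≤ |M.op a b| * 2 ^ (γ + 1))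
    (h2 : |M.op a b| * 2 ^ (γ + 1) < 2 ^ (R.manBits + 1) * R.quantum) (h3 : |M.op a b| ≤ R.maxRat) :
    |(B.fl (M.op a b)).toRat - M.op a b| ≤ maxList0 (lowErrsOf B.errL R γ M.pats) * R.quantum := by
  obtain ⟨N, E, hmem, ht⟩ := M.mem_pats a b
  have hB := (lowBandB_iff_of_eq ht).mpr ⟨h1, h2, h3⟩
  have hle := B.abs_le _ _ _ (lowN_lt_of_lowBandB hB) (abs_low_of_eq ht) h3
  rw [abs_sub_comm]
  exact le_trans hle (mul_le_mul_of_nonneg_right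
    (le_maxList0_of_mem (mem_lowErrsOf.mpr ⟨N, E, hmem, hB, rfl⟩)) R.quantum_pos.le)

/-- ATTAINMENT PER LOW BAND (quanta): once one pattern is placed in low band `γ`, the constant is
the error of a result in that band. [folklore] -/
theorem low_attained {R : Format} (B : LowBridge R) (M : OpModel X Y R) (γ : ℕ)
    (hne : lowErrsOf B.errL R γ M.pats ≠ []) :
    ∃ (a : MiniFloat X) (b : MiniFloat Y),
      2 ^ R.manBits * R.quantum ≤ |M.op a b| * 2 ^ (γ + 1) ∧
      |M.op a b| * 2 ^ (γ + 1) < 2 ^ (R.manBits + 1) * R.quantum ∧ |M.op a b| ≤ R.maxRat ∧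
      |(B.fl (M.op a b)).toRat - M.op a b| = maxList0 (lowErrsOf B.errL R γ M.pats) * R.quantum := by
  have hmem := maxList0_mem_of_ne_nil hne (fun c hc => by
    obtain ⟨N, E, -, -, rfl⟩ := mem_lowErrsOf.mp hc
    exact B.errL_nonneg _ _)
  obtain ⟨N, E, hp, hb, hc⟩ := mem_lowErrsOf.mp hmem
  have hN : N ≠ 0 := by
    intro h0
    have h := (lowBandB_eq_true_iff.mp hb).1
    rw [h0, Nat.cast_zero, zero_mul, zero_mul] at h
    exact absurd h (not_le.mpr (by positivity))
  obtain ⟨a, b, ht, hsgn⟩ := M.realise N E (B.sgn (lowN N E) (lowK E)) hp hN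
  have hband := (lowBandB_iff_of_eq ht).mp hb
  have heq := B.abs_eq _ _ _ (ne_zero_of_lowBand hband.1) hsgn (lowN_lt_of_lowBandB hb)
    (abs_low_of_eq ht) hband.2.2
  exact ⟨a, b, hband.1, hband.2.1, hband.2.2, by rw [abs_sub_comm, heq, hc]⟩

end MiniFloat

/-! ### The named low-band constants (units of the quantum = ulps) -/

/-- LOW-BAND CONSTANT, products, nearest. [folklore] -/
def envconstMulLowNE (X Y R : Format) (γ : ℕ) : ℚ :=
  maxList0 (lowErrsOf lowErrNE R γ (mulPats X Y R))

/-- LOW-BAND CONSTANT, products, toward zero. [folklore] -/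
def envconstMulLowTZ (X Y R : Format) (γ : ℕ) : ℚ :=
  maxList0 (lowErrsOf lowErrTZ R γ (mulPats X Y R))

/-- LOW-BAND CONSTANT, products, round down / round up. [folklore] -/
def envconstMulLowDir (X Y R : Format) (γ : ℕ) : ℚ :=
  maxList0 (lowErrsOf lowErrDir R γ (mulPats X Y R))

/-- LOW-BAND CONSTANT, sums, nearest. [folklore] -/
def envconstAddLowNE (X Y R : Format) (γ : ℕ) : ℚ :=
  maxList0 (lowErrsOf lowErrNE R γ (addPats X Y R))

/-- LOW-BAND CONSTANT, sums, toward zero. [folklore] -/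
def envconstAddLowTZ (X Y R : Format) (γ : ℕ) : ℚ :=
  maxList0 (lowErrsOf lowErrTZ R γ (addPats X Y R))

/-- LOW-BAND CONSTANT, sums, round down / round up. [folklore] -/
def envconstAddLowDir (X Y R : Format) (γ : ℕ) : ℚ :=
  maxList0 (lowErrsOf lowErrDir R γ (addPats X Y R))

namespace MiniFloat

variable {X Y : Format}

/-- PRODUCTS, NEAREST, low band `γ`: `|RNE(a·b) − a·b| ≤ envconstMulLowNE · quantum`. [folklore] -/
theorem mul_lowNE_le (R : Format) (γ : ℕ) (a : MiniFloat X) (b : MiniFloat Y)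
    (h1 : 2 ^ R.manBits * R.quantum ≤ |a.toRat * b.toRat| * 2 ^ (γ + 1))
    (h2 : |a.toRat * b.toRat| * 2 ^ (γ + 1) < 2 ^ (R.manBits + 1) * R.quantum)
    (h3 : |a.toRat * b.toRat| ≤ R.maxRat) :
    |(roundNE R (a.toRat * b.toRat)).toRat - a.toRat * b.toRat|
      ≤ envconstMulLowNE X Y R γ * R.quantum :=
  low_le (lowBridgeNE R) (mulModel X Y R) γ a b h1 h2 h3

/-- PRODUCTS, NEAREST, low band `γ`: the constant is attained once the band is populated.
[folklore] -/
theorem mul_lowNE_attained (R : Format) (γ : ℕ)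
    (hne : lowErrsOf lowErrNE R γ (mulPats X Y R) ≠ []) :
    ∃ (a : MiniFloat X) (b : MiniFloat Y),
      2 ^ R.manBits * R.quantum ≤ |a.toRat * b.toRat| * 2 ^ (γ + 1) ∧
      |a.toRat * b.toRat| * 2 ^ (γ + 1) < 2 ^ (R.manBits + 1) * R.quantum ∧
      |a.toRat * b.toRat| ≤ R.maxRat ∧
      |(roundNE R (a.toRat * b.toRat)).toRat - a.toRat * b.toRat|
        = envconstMulLowNE X Y R γ * R.quantum :=
  low_attained (lowBridgeNE R) (mulModel X Y R) γ hne

/-- SUMS, TOWARD ZERO, low band `γ`: `|RZ(a+b) − (a+b)| ≤ envconstAddLowTZ · quantum`. [folklore] -/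
theorem add_lowTZ_le (R : Format) (γ : ℕ) (a : MiniFloat X) (b : MiniFloat Y)
    (h1 : 2 ^ R.manBits * R.quantum ≤ |a.toRat + b.toRat| * 2 ^ (γ + 1))
    (h2 : |a.toRat + b.toRat| * 2 ^ (γ + 1) < 2 ^ (R.manBits + 1) * R.quantum)
    (h3 : |a.toRat + b.toRat| ≤ R.maxRat) :
    |(roundTowardZero R (a.toRat + b.toRat)).toRat - (a.toRat + b.toRat)|
      ≤ envconstAddLowTZ X Y R γ * R.quantum :=
  low_le (lowBridgeTZ R) (addModel X Y R) γ a b h1 h2 h3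

/-- SUMS, ROUND DOWN, low band `γ`: `|RD(a+b) − (a+b)| ≤ envconstAddLowDir · quantum`. [folklore] -/
theorem add_lowRD_le (R : Format) (γ : ℕ) (a : MiniFloat X) (b : MiniFloat Y)
    (h1 : 2 ^ R.manBits * R.quantum ≤ |a.toRat + b.toRat| * 2 ^ (γ + 1))
    (h2 : |a.toRat + b.toRat| * 2 ^ (γ + 1) < 2 ^ (R.manBits + 1) * R.quantum)
    (h3 : |a.toRat + b.toRat| ≤ R.maxRat) :
    |(roundDown R (a.toRat + b.toRat)).toRat - (a.toRat + b.toRat)|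
      ≤ envconstAddLowDir X Y R γ * R.quantum :=
  low_le (lowBridgeRD R) (addModel X Y R) γ a b h1 h2 h3

/-- SUMS, ROUND UP, low band `γ`: the constant `envconstAddLowDir` is attained. [folklore] -/
theorem add_lowRU_attained (R : Format) (γ : ℕ)
    (hne : lowErrsOf lowErrDir R γ (addPats X Y R) ≠ []) :
    ∃ (a : MiniFloat X) (b : MiniFloat Y),
      2 ^ R.manBits * R.quantum ≤ |a.toRat + b.toRat| * 2 ^ (γ + 1) ∧
      |a.toRat + b.toRat| * 2 ^ (γ + 1) < 2 ^ (R.manBits + 1) * R.quantum ∧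
      |a.toRat + b.toRat| ≤ R.maxRat ∧
      |(roundUp R (a.toRat + b.toRat)).toRat - (a.toRat + b.toRat)|
        = envconstAddLowDir X Y R γ * R.quantum :=
  low_attained (lowBridgeRU R) (addModel X Y R) γ hne

end MiniFloat

end Literature.ComputerArithmetic.FloatingPoint
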